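import Summits.BirchSwinnertonDyer.Rank1Residual.F1Sign2.DoorValueSupplySharpAtTwo
import Summits.BirchSwinnertonDyer.BirchSwinnertonDyer.Theorems.ByReductionTypeAtTwoRankOneAtTwoBigImageOddLocalOneDoorBottomFrameCTFree
import Summits.BirchSwinnertonDyer.BirchSwinnertonDyer.Theorems.GenusKolyvaginAtTwoGenusPrimitiveSupplyAtTwoTwistMixedBounds
import HarnessLib

/-!
# Cell `bsd-f1-sign2`, AN-33 Nalg′ / Nalg PROVED: `selmerCardLeTwistMulAtDoor_holds`, `pureDoorSelmerCardEqAtNegDisc_holds` (-ty g12; REF1 §134 turnkey r134-2)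

KERNEL PROOFS (cell `bsd-f1-sign2`, seat `-ty` g12) of the two THEOREM-GRADE support rows of `F1Sign2/DoorValueSupplySharpAtTwo.lean` (p661739;
-an g16 Sketch_v41 §17): Nalg′ `SelmerCardLeTwistMulAtDoor` (`#Sel₂(W) ≤ 2^{t+2s+[Δ_W>0]} · #Sel₂(W^{(d)})` at every door-admissible `d`) and
Nalg `PureDoorSelmerCardEqAtNegDisc` (`Δ_W < 0`, pure door ⇒ `#Sel₂(W^{(d)}) = #Sel₂(W)`), exactly along REF1 §134 (3) / r134-2
(refuter-bsd-f1-sign2-ref1 g12, `HOME/REF1-AUDIT-v1.md` l.2586): both are instances of gk2-p5's UNCONDITIONAL kernel theorem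
`GenusKolyTwistLocal.natCard_selmerGroup_twist_bounds_mixed` (p660332; Mazur–Rubin 2010 Prop. 3.3 bounds + Kramer 1981 Thm. 1 / Prop. 6, via
Poitou–Tate with real places, Tate's local Euler characteristic, Lemmas 2.9–2.11 and Kramer's congruence — all tree theorems) with `K = ℚ`, `C = 1`
(`Wd = W.quadraticTwist d`, so `#Sel₂(Wd) = twistSelmerTwoCard W d` on the nose), `T :=` the places of ALL primes `q ∣ d`
(`doorPlaces d`), `e_v := log₂ #W(ℚ_v)[2]` (`doorExp`), `R := {∞}` iff `Δ_W > 0` (`natCard_selmerGroup_twist_bounds_rat_of_Δ_pos`) and `R := ∅` at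
`Δ_W < 0` (`twist_place_menu_infinite_rat`); every finite `v ∉ T` is on the five-row menu by the one-door line's `door_place_menu₅` (fkl-p2 g12,
p660513; the silent-prime hypothesis is vacuous off `T`).  The door dictionary `Σ_{v∈T} e_v ≤ t + 2s` is proved prime by prime: at `q ∣ d`
(odd, good, `q ∤ Δ_min`) `#W(ℚ_q)[2] = 1 + #Fix(Frob_q on the three letters) ∈ {1, 2, 4}` (`exists_natCard_ker_nsmul_adicCompletion_two_eq_two_pow`,
via `FrobShape.exists_frobenius_natCard_fixed_eq`, `ReductionCyclic.natCard_ker_zsmul_adicCompletion_eq`, `natCard_fixed_geomTorsion_two_eq` and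
the fact-free count «a permutation of three letters fixes 0, 1 or 3 letters»), `= 1` when `a_q` is odd (`natCard_ker_nsmul_adicCompletion_eq_one_of_odd`:
no root of the 2-division cubic mod `q`, Hensel — the lead's `natCard_twoTorsion_eq_one_of_descMinimal` argument per prime), `= 2` when
`(Δ_min⁄q) = −1` (the lead's `natCard_ker_nsmul_adicCompletion_two_eq_two_of_jacobiSym`); so `e_q ≤ [(Δ⁄q) = −1] + 2·[(Δ⁄q) = 1 ∧ a_q even]`
(`doorExp_placeOf_le`) and `t + 2s = Σ_{q ∣ d} ([(Δ⁄q) = −1] + 2·[(Δ⁄q) = 1 ∧ a_q even])` (`transpCount_add_two_mul_identCount`).  For Nalg,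
`T = ∅` (every prime of a pure door is silent: `natCard_twoTorsion_eq_one_of_descMinimal`) and `R = ∅` give both inequalities with `2⁰`.
No new definition of mathematical content (two bookkeeping abbreviations `placeOf`, `doorPlaces`, `doorExp`); no named fact, no `sorry`, std axioms.
EFFECT (director ruling v4.0-add1 (3)(a)): Nalg′ and Nalg become KERNEL theorems — KNOWN content (REF2 v40 §2: MR 2010 Cor. 3.4 (ii) / Prop. 3.3 eq. (4) +
Kramer i_∞; beyond-print no); AN-33 N `UnitDoorSelmerFloorAtTwo` is thereby reduced IN THE KERNEL to -an's single non-printed step `hBSD`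
(`unitDoorSelmerFloorAtTwo_of_algebraic selmerCardLeTwistMulAtDoor_holds hBSD`).  Nothing here proves BSD; 23715 not closed; PARTITION none.
[cite: MazurRubin2010, Prop. 3.3, Cor. 3.4, Lemmas 2.2, 2.9–2.11] [cite: Kramer1981, Thm. 1, Props. 3, 6] [cite: SilvermanAEC2009, Prop. VII.4.1, III.§7]
-/

set_option autoImplicit false

noncomputable section

open scoped Classical

namespace Summit.BirchSwinnertonDyer.Rank1Residual.F1Sign2.ANg16.DoorSelmer

open WeierstrassCurve NumberField IsDedekindDomain Rat.HeightOneSpectrum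
  Literature.NumberTheory.EllipticCurves Literature.NumberTheory.EllipticCurves.ModularForms
  Literature.NumberTheory.GaloisRepresentations Literature.NumberTheory.EllipticCurves.DokchitserDokchitser2012
  Summit.BirchSwinnertonDyer.Rank1Residual.F1Sign2
  Summit.BirchSwinnertonDyer.BirchSwinnertonDyer.Theorems
  Summit.BirchSwinnertonDyer.BirchSwinnertonDyer.Theorems.RankOneAtTwoOneDoor

/-! ### §1 Local 2-torsion counts at an odd good prime -/

/-- Fixed points of a permutation of three letters number 0, 1 or 3. -/
theorem card_fixedPoints_perm_three_mem (g : Equiv.Perm (Fin 3)) :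
    Fintype.card {i : Fin 3 // g i = i} = 0 ∨ Fintype.card {i : Fin 3 // g i = i} = 1 ∨
      Fintype.card {i : Fin 3 // g i = i} = 3 := by
  revert g
  decide

/-- At an odd prime of good reduction, `#W(ℚ_v)[2] = 2^e` with `e ≤ 2`. -/
theorem exists_natCard_ker_nsmul_adicCompletion_two_eq_two_pow (W : WeierstrassCurve ℚ) [W.IsElliptic] [W.IsGloballyMinimal]
    {q : ℕ} [Fact q.Prime] (hq2 : q ≠ 2) (hgood : W.HasGoodReductionAtPrime q)
    {v : HeightOneSpectrum (𝓞 ℚ)} (hv : (q : 𝓞 ℚ) ∈ v.asIdeal) :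
    ∃ e : ℕ, e ≤ 2 ∧
      Nat.card (nsmulAddMonoidHom 2 : (W.baseChange (v.adicCompletion ℚ)).toAffine.Point →+ _).ker = 2 ^ e := by
  haveI : Fact (Nat.Prime 2) := ⟨Nat.prime_two⟩
  have hq : q.Prime := Fact.out
  have hvq : (Rat.HeightOneSpectrum.primesEquiv v : ℕ) = q := primesEquiv_eq_of_natCast_mem hq hv
  have hgoodv : W.HasGoodReductionAt v := (hasGoodReductionAtPrime_primesEquiv_iff_holds W v q hvq).mp hgood
  have hnv : (((2 : ℤ)) : 𝓞 ℚ) ∉ v.asIdeal := by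
    intro hmem
    have h2 : ((2 : ℕ) : 𝓞 ℚ) ∈ v.asIdeal := by exact_mod_cast hmem
    exact hq2 (hvq.symm.trans (primesEquiv_eq_of_natCast_mem Nat.prime_two h2))
  obtain ⟨σ₀, 𝔓₀', h𝔓₀', hσ₀, -⟩ :=
    Summit.BirchSwinnertonDyer.Rank1Residual.GaloisImage.FrobShape.exists_frobenius_natCard_fixed_eq W 2 q hq2 hgood hv
  have h𝔓₀ := adicCompletionPrime_mem_primesAbove ℚ v
  obtain ⟨g, hg⟩ := HeightOneSpectrum.exists_smul_eq_of_mem_primesAbove_holds h𝔓₀' h𝔓₀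
  have hΦ : IsArithFrobAt (𝓞 ℚ) (g * σ₀ * g⁻¹) (adicCompletionPrime ℚ v) := hg ▸ hσ₀.conj g
  have he : (zsmulAddGroupHom (2 : ℤ) : (W.baseChange (v.adicCompletion ℚ)).toAffine.Point →+ _) = nsmulAddMonoidHom 2 :=
    AddMonoidHom.ext fun a => natCast_zsmul a 2
  rw [← he, GenusExact.ReductionCyclic.natCard_ker_zsmul_adicCompletion_eq W two_ne_zero hgoodv hnv hΦ,
    natCard_fixed_geomTorsion_two_eq W (two_ne_zero : (2 : ℚ) ≠ 0), Nat.card_eq_fintype_card]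
  rcases card_fixedPoints_perm_three_mem (permGal W (two_ne_zero : (2 : ℚ) ≠ 0) (g * σ₀ * g⁻¹)) with h | h | h <;>
    rw [h]
  · exact ⟨0, by norm_num, by norm_num⟩
  · exact ⟨1, by norm_num, by norm_num⟩
  · exact ⟨2, le_rfl, by norm_num⟩

/-- At an odd good prime `q` with `a_q` odd (a `3`-cycle prime), `#W(ℚ_v)[2] = 1`. -/
theorem natCard_ker_nsmul_adicCompletion_eq_one_of_odd (W : WeierstrassCurve ℚ) [W.IsElliptic] [W.IsGloballyMinimal]
    {q : ℕ} (hq : q.Prime) (hq2 : q ≠ 2) (hgood : ∀ _h : Fact q.Prime, W.HasGoodReductionAtPrime q)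
    (hodd : Odd (W.frobeniusTrace q))
    {v : HeightOneSpectrum (𝓞 ℚ)} (hv : (q : 𝓞 ℚ) ∈ v.asIdeal) :
    Nat.card (nsmulAddMonoidHom 2 : (W.baseChange (v.adicCompletion ℚ)).toAffine.Point →+ _).ker = 1 := by
  haveI : Fact q.Prime := ⟨hq⟩
  have hgood' : W.HasGoodReductionAtPrime q := hgood ⟨hq⟩
  have hqΔmin : ¬ (q : ℤ) ∣ minimalDiscriminantInt W := not_dvd_minimalDiscriminantInt_of_hasGoodReductionAtPrime' W q hgood'
  have hnoroot := (TwoAdicTwistConverse.odd_frobeniusTrace_iff_forall_ne_zero W q hq2 hgood').mp hodd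
  have hzero := GenusKolyTwin.twoTorsion_padic_eq_zero_of_forall_ne W hq2 hqΔmin hnoroot
  exact W.natCard_ker_nsmul_adicCompletion_eq_one_of_forall_padic hv (n := 2) hzero


/-! ### §2 The door places and the count `t + 2s` as a sum over the primes of `d` -/

/-- The place of `ℚ` at a natural number (`primesEquiv.symm` at a prime; the place of `2` as junk value otherwise). -/
def placeOf (q : ℕ) : HeightOneSpectrum (𝓞 ℚ) :=
  if hq : q.Prime then primesEquiv.symm ⟨q, hq⟩ else primesEquiv.symm ⟨2, Nat.prime_two⟩

/-- The prime of the place of a prime is the prime. [folklore] -/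
theorem primesEquiv_placeOf {q : ℕ} (hq : q.Prime) : (primesEquiv (placeOf q) : ℕ) = q := by
  rw [placeOf, dif_pos hq, Equiv.apply_symm_apply]

/-- A prime lies in (the ideal of) its place. [folklore] -/
theorem natCast_mem_placeOf {q : ℕ} (hq : q.Prime) : (q : 𝓞 ℚ) ∈ (placeOf q).asIdeal := by
  have h := Rat.HeightOneSpectrum.natCast_natGenerator_mem (placeOf q)
  rwa [show Rat.HeightOneSpectrum.natGenerator (placeOf q) = q from primesEquiv_placeOf hq] at h

/-- The place of the prime of a place is the place. [folklore] -/
theorem placeOf_primesEquiv (v : HeightOneSpectrum (𝓞 ℚ)) : placeOf (primesEquiv v : ℕ) = v := by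
  rw [placeOf, dif_pos (primesEquiv v).2]
  exact primesEquiv.symm_apply_apply v

/-- `placeOf` is injective on primes. [folklore] -/
theorem placeOf_injOn (s : Finset ℕ) (hs : ∀ q ∈ s, q.Prime) : Set.InjOn placeOf s := by
  intro a ha b hb hab
  have h := congrArg (fun v => (primesEquiv v : ℕ)) hab
  simp only [primesEquiv_placeOf (hs a ha), primesEquiv_placeOf (hs b hb)] at h
  exact h

/-- The door places: the places of the primes of `d`. -/
def doorPlaces (d : ℤ) : Finset (HeightOneSpectrum (𝓞 ℚ)) := d.natAbs.primeFactors.image placeOf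

/-- A place is a door place iff its prime divides `d`. [folklore] -/
theorem mem_doorPlaces_iff {d : ℤ} (hd : d ≠ 0) (v : HeightOneSpectrum (𝓞 ℚ)) :
    v ∈ doorPlaces d ↔ ((primesEquiv v : ℕ) : ℤ) ∣ d := by
  constructor
  · intro hv
    obtain ⟨q, hq, rfl⟩ := Finset.mem_image.mp hv
    have hqp : q.Prime := Nat.prime_of_mem_primeFactors hq
    rw [primesEquiv_placeOf hqp]
    exact Int.ofNat_dvd_left.mpr (Nat.dvd_of_mem_primeFactors hq)
  · intro hdvd
    refine Finset.mem_image.mpr ⟨(primesEquiv v : ℕ), ?_, placeOf_primesEquiv v⟩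
    exact Nat.mem_primeFactors.mpr ⟨(primesEquiv v).2, Int.ofNat_dvd_left.mp hdvd, Int.natAbs_ne_zero.mpr hd⟩

/-- A sum over the door places is the sum over the primes of `d`. [folklore] -/
theorem sum_doorPlaces {d : ℤ} (f : HeightOneSpectrum (𝓞 ℚ) → ℕ) :
    ∑ v ∈ doorPlaces d, f v = ∑ q ∈ d.natAbs.primeFactors, f (placeOf q) :=
  Finset.sum_image (placeOf_injOn _ fun _ hq => Nat.prime_of_mem_primeFactors hq)

/-- `t + 2s` as a sum over the primes of `d`. -/
theorem transpCount_add_two_mul_identCount (W : WeierstrassCurve ℚ) [W.IsGloballyMinimal] (d : ℤ) :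
    transpCount W d + 2 * identCount W d =
      ∑ q ∈ d.natAbs.primeFactors,
        ((if jacobiSym W.Δ.num q = -1 then 1 else 0) +
          2 * (if jacobiSym W.Δ.num q = 1 ∧ Even (W.frobeniusTrace q) then 1 else 0)) := by
  unfold transpCount identCount
  rw [Finset.card_filter, Finset.card_filter, Finset.sum_add_distrib, Finset.mul_sum]


/-! ### §3 The door dictionary: `e_q ≤ [(Δ/q) = −1] + 2·[(Δ/q) = 1 ∧ a_q even]` at every prime `q ∣ d` -/

/-- `e_v := log₂ #W(ℚ_v)[2]`. -/
def doorExp (W : WeierstrassCurve ℚ) (v : HeightOneSpectrum (𝓞 ℚ)) : ℕ :=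
  Nat.log 2 (Nat.card (nsmulAddMonoidHom 2 : (W.baseChange (v.adicCompletion ℚ)).toAffine.Point →+ _).ker)

section Door

variable (W : WeierstrassCurve ℚ) [W.IsElliptic] [W.IsGloballyMinimal]

omit [W.IsElliptic] in
/-- The data of a prime `q ∣ d` of a door: `q` prime, odd, good, `q ∤ Δ_min = Δ.num`, `(Δ/q) ≠ 0`. -/
theorem door_prime_data {d : ℤ} (hadm : DoorAdmissible W d) {q : ℕ} (hq : q ∈ d.natAbs.primeFactors) :
    q.Prime ∧ (q : ℤ) ∣ d ∧ q ≠ 2 ∧ (∀ _h : Fact q.Prime, W.HasGoodReductionAtPrime q) ∧ ¬ (q : ℤ) ∣ W.Δ.num ∧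
      (jacobiSym W.Δ.num q = 1 ∨ jacobiSym W.Δ.num q = -1) := by
  obtain ⟨hdneg, -, hd8, hgoodd, -⟩ := hadm
  have hqp : q.Prime := Nat.prime_of_mem_primeFactors hq
  have hqd : (q : ℤ) ∣ d := Int.ofNat_dvd_left.mpr (Nat.dvd_of_mem_primeFactors hq)
  have hq2 : q ≠ 2 := by
    intro h2
    rw [h2] at hqd
    have h2d : (2 : ℤ) ∣ d := by exact_mod_cast hqd
    omega
  have hgood : ∀ _h : Fact q.Prime, W.HasGoodReductionAtPrime q := hgoodd q hqp hqd
  haveI : Fact q.Prime := ⟨hqp⟩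
  have hqΔmin : ¬ (q : ℤ) ∣ minimalDiscriminantInt W :=
    not_dvd_minimalDiscriminantInt_of_hasGoodReductionAtPrime' W q (hgood ⟨hqp⟩)
  have hnum : W.Δ.num = minimalDiscriminantInt W := by rw [← cast_minimalDiscriminantInt W, Rat.num_intCast]
  have hqΔ : ¬ (q : ℤ) ∣ W.Δ.num := by rw [hnum]; exact hqΔmin
  have hgcd : Int.gcd W.Δ.num q = 1 := by
    have hcop : Nat.Coprime q W.Δ.num.natAbs :=
      (Nat.Prime.coprime_iff_not_dvd hqp).mpr fun h => hqΔ (Int.ofNat_dvd_left.mpr h)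
    change W.Δ.num.natAbs.gcd (q : ℤ).natAbs = 1
    rw [Int.natAbs_natCast]
    exact hcop.symm
  have hj : jacobiSym W.Δ.num q = 1 ∨ jacobiSym W.Δ.num q = -1 := by
    rcases jacobiSym.trichotomy W.Δ.num q with h0 | h1 | hm1
    · exact absurd hgcd (jacobiSym.eq_zero_iff.mp h0).2
    · exact Or.inl h1
    · exact Or.inr hm1
  exact ⟨hqp, hqd, hq2, hgood, hqΔ, hj⟩

/-- **The door dictionary, prime by prime**: at a prime `q ∣ d` of a door, `log₂ #W(ℚ_q)[2] ≤ [(Δ/q) = −1] + 2·[(Δ/q) = 1 ∧ a_q even]`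
(`= 0` at a `3`-cycle prime, `= 1` at a transposition prime, `≤ 2` at an identity prime). [cite: Kramer1981, Prop. 3] [cite: MazurRubin2010, Lemma 2.2 (i)] -/
theorem doorExp_placeOf_le {d : ℤ} (hadm : DoorAdmissible W d) {q : ℕ} (hq : q ∈ d.natAbs.primeFactors) :
    doorExp W (placeOf q) ≤
      (if jacobiSym W.Δ.num q = -1 then 1 else 0) +
        2 * (if jacobiSym W.Δ.num q = 1 ∧ Even (W.frobeniusTrace q) then 1 else 0) := by
  obtain ⟨hqp, -, hq2, hgood, hqΔ, hj⟩ := door_prime_data W hadm hq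
  haveI : Fact q.Prime := ⟨hqp⟩
  have hv : (q : 𝓞 ℚ) ∈ (placeOf q).asIdeal := natCast_mem_placeOf hqp
  unfold doorExp
  by_cases heven : Even (W.frobeniusTrace q)
  · rcases hj with h1 | hm1
    · -- identity prime: `#W(ℚ_q)[2] = 2^e`, `e ≤ 2`
      obtain ⟨e, he2, hcard⟩ := exists_natCard_ker_nsmul_adicCompletion_two_eq_two_pow W hq2 (hgood ⟨hqp⟩) hv
      have hne : jacobiSym W.Δ.num q ≠ -1 := by rw [h1]; decide
      rw [hcard, Nat.log_pow Nat.one_lt_two, if_neg hne, if_pos ⟨h1, heven⟩]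
      omega
    · -- transposition prime: `#W(ℚ_q)[2] = 2`
      have hlog : Nat.log 2 2 = 1 := by simpa using Nat.log_pow Nat.one_lt_two 1
      rw [natCard_ker_nsmul_adicCompletion_two_eq_two_of_jacobiSym W hq2 (hgood ⟨hqp⟩) hqΔ hm1 hv, hlog, if_pos hm1]
      omega
  · -- `3`-cycle prime (odd `a_q`): `#W(ℚ_q)[2] = 1`
    rw [natCard_ker_nsmul_adicCompletion_eq_one_of_odd W hqp hq2 hgood (Int.not_even_iff_odd.mp heven) hv, Nat.log_one_right]
    exact Nat.zero_le _

/-- **`Σ_{v ∈ T} e_v ≤ t + 2s`** for `T` = the places of the primes of `d`. -/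
theorem sum_doorExp_le {d : ℤ} (hadm : DoorAdmissible W d) :
    ∑ v ∈ doorPlaces d, doorExp W v ≤ transpCount W d + 2 * identCount W d := by
  rw [sum_doorPlaces, transpCount_add_two_mul_identCount]
  exact Finset.sum_le_sum fun q hq => doorExp_placeOf_le W hadm hq

/-- The `T`-place hypotheses of `natCard_selmerGroup_twist_bounds_mixed` at the door places: odd, good, RAMIFIED in `ℚ(√d)`
(`v(d) = 1`, `d` squarefree), `#W(ℚ_v)[2] = 2^{e_v}`. -/
theorem doorPlaces_hyps {d : ℤ} (hadm : DoorAdmissible W d) :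
    (∀ v ∈ doorPlaces d, ((2 : ℕ) : 𝓞 ℚ) ∉ v.asIdeal) ∧
    (∀ v ∈ doorPlaces d, W.HasGoodReductionAt v) ∧
    (∀ v ∈ doorPlaces d, closureEmb (K := ℚ) (v.adicCompletion ℚ) (geomSqrt (d : ℚ)) ∉
        IsNonarchimedeanLocalField.maxUnramified (v.adicCompletion ℚ)) ∧
    (∀ v ∈ doorPlaces d, Nat.card (nsmulAddMonoidHom 2 : (W.baseChange (v.adicCompletion ℚ)).toAffine.Point →+ _).ker =
        2 ^ doorExp W v) := by
  have hsq : Squarefree d := hadm.2.1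
  refine ⟨?_, ?_, ?_, ?_⟩ <;> intro v hv <;> obtain ⟨q, hq, rfl⟩ := Finset.mem_image.mp hv <;>
    obtain ⟨hqp, hqd, hq2, hgood, -, -⟩ := door_prime_data W hadm hq <;>
    have hqv : (q : 𝓞 ℚ) ∈ (placeOf q).asIdeal := natCast_mem_placeOf hqp
  · exact GenusKolyTwistingPrime.natCast_not_mem_of_not_dvd hqp hqv fun h =>
      hq2 ((Nat.prime_dvd_prime_iff_eq hqp Nat.prime_two).mp h)
  · haveI : Fact q.Prime := ⟨hqp⟩
    exact (hasGoodReductionAtPrime_primesEquiv_iff_holds W (placeOf q) q (primesEquiv_placeOf hqp)).mp (hgood ⟨hqp⟩)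
  · apply GenusKolyTwistRamified.closureEmb_geomSqrt_not_mem_maxUnramified_rat (placeOf q)
    -- `d = q · m` with `q ∤ m`, so `v(d) = exp(-1) · 1`
    obtain ⟨m, hm⟩ := id hqd
    have hqm : ¬ (q : ℤ) ∣ m := by
      rintro ⟨k, hk⟩
      have hu : IsUnit (q : ℤ) := hsq (q : ℤ) ⟨k, by rw [hm, hk]; ring⟩
      have h2 : (2 : ℤ) ≤ q := by exact_mod_cast hqp.two_le
      rcases Int.isUnit_iff.mp hu with h | h <;> omega
    have hmv : ((m : ℤ) : 𝓞 ℚ) ∉ (placeOf q).asIdeal := fun h =>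
      hqm ((Literature.NumberTheory.NumberFields.intCast_mem_asIdeal_iff_of_natCast_mem hqp (placeOf q) hqv m).mp h)
    have hm1 : (placeOf q).valuation ℚ (m : ℚ) = 1 := by
      have h := (HeightOneSpectrum.valuation_eq_one_iff_notMem (K := ℚ) (v := placeOf q) (r := ((m : ℤ) : 𝓞 ℚ))).mpr hmv
      rwa [map_intCast] at h
    rw [hm, Int.cast_mul, Int.cast_natCast, map_mul,
      GenusKolyTwistRamified.valuation_natCast_eq_exp_neg_one_of_mem (placeOf q) hqp hqv, hm1, mul_one]
  · haveI : Fact q.Prime := ⟨hqp⟩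
    obtain ⟨e, -, hcard⟩ := exists_natCard_ker_nsmul_adicCompletion_two_eq_two_pow W hq2 (hgood ⟨hqp⟩) hqv
    rw [doorExp, hcard, Nat.log_pow Nat.one_lt_two]

end Door

end Summit.BirchSwinnertonDyer.Rank1Residual.F1Sign2.ANg16.DoorSelmer

/-! ### §4 The two support rows of AN-33, PROVED -/

namespace Summit.BirchSwinnertonDyer.Rank1Residual.F1Sign2.ANg16

open WeierstrassCurve NumberField IsDedekindDomain
  Literature.NumberTheory.EllipticCurves Literature.NumberTheory.GaloisRepresentations
  Summit.BirchSwinnertonDyer.Rank1Residual.F1Sign2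
  Summit.BirchSwinnertonDyer.BirchSwinnertonDyer.Theorems
  Summit.BirchSwinnertonDyer.BirchSwinnertonDyer.Theorems.RankOneAtTwoOneDoor
  Summit.BirchSwinnertonDyer.Rank1Residual.F1Sign2.ANg16.DoorSelmer

/-- **AN-33 Nalg′ `SelmerCardLeTwistMulAtDoor` PROVED** (REF1 §134 r134-2): for `W/ℚ` globally minimal elliptic and a door-admissible `d`,
`#Sel₂(W) ≤ 2^{t + 2s + [Δ_W > 0]} · #Sel₂(W^{(d)})` — the second inequality of `GenusKolyTwistLocal.natCard_selmerGroup_twist_bounds_mixed` at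
`T = doorPlaces d`, `e = doorExp W`, `R = {∞}` iff `Δ_W > 0`, with `Σ_T e ≤ t + 2s` (`sum_doorExp_le`).
[cite: MazurRubin2010, Prop. 3.3 (eq. (4)), Lemma 2.11] [cite: Kramer1981, Thm. 1, Prop. 6] -/
theorem selmerCardLeTwistMulAtDoor_holds : SelmerCardLeTwistMulAtDoor := by
  intro W _ _ d hadm
  have hdneg : d < 0 := hadm.1
  have hd0' : d ≠ 0 := hdneg.ne
  have hd0 : (d : ℚ) ≠ 0 := by exact_mod_cast hd0'
  haveI := W.isElliptic_quadraticTwist hd0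
  have hC : (1 : VariableChange ℚ) • W.quadraticTwist (d : ℚ) = W.quadraticTwist (d : ℚ) := one_smul _ _
  obtain ⟨hT2, hTgood, hTram, hTt⟩ := doorPlaces_hyps W hadm
  have hfin := fun v (hv : v ∉ doorPlaces d) => door_place_menu₅ W hadm hC v fun hdv =>
    absurd ((mem_doorPlaces_iff hd0' v).mpr
      ((Literature.NumberTheory.NumberFields.intCast_mem_asIdeal_iff_of_natCast_mem (Rat.HeightOneSpectrum.primesEquiv v).2 v
        (Rat.HeightOneSpectrum.natCast_natGenerator_mem v) d).mp hdv)) hv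
  have hsum := sum_doorExp_le W hadm
  unfold twistSelmerTwoCard
  by_cases hΔ : 0 < W.Δ
  · have hdq : (d : ℚ) < 0 := by exact_mod_cast hdneg
    obtain ⟨-, h2, -⟩ := GenusKolyTwistLocal.natCard_selmerGroup_twist_bounds_rat_of_Δ_pos W (W.quadraticTwist (d : ℚ)) hΔ hdq hC
      (doorPlaces d) (doorExp W) hT2 hTgood hTram hTt hfin
    rw [if_pos hΔ]
    calc Nat.card (W.selmerGroup 2)
        ≤ 2 ^ (∑ v ∈ doorPlaces d, doorExp W v + 1) * Nat.card ((W.quadraticTwist (d : ℚ)).selmerGroup 2) := by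
          simpa only [Nat.cast_ofNat] using h2
      _ ≤ 2 ^ (transpCount W d + 2 * identCount W d + 1) * Nat.card ((W.quadraticTwist (d : ℚ)).selmerGroup 2) :=
          Nat.mul_le_mul_right _ (Nat.pow_le_pow_right Nat.two_pos (by omega))
  · have hΔneg : W.Δ < 0 := lt_of_le_of_ne (not_lt.mp hΔ) W.isUnit_Δ.ne_zero
    have hinf := GenusKolyTwistLocal.twist_place_menu_infinite_rat W hΔneg hd0 hC
    obtain ⟨-, h2, -⟩ := GenusKolyTwistLocal.natCard_selmerGroup_twist_bounds_mixed W (W.quadraticTwist (d : ℚ)) hd0 hC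
      (doorPlaces d) (doorExp W) ∅ hT2 hTgood hTram hTt (by simp) (by simp) hfin (fun w _ => hinf w)
    rw [if_neg hΔ]
    calc Nat.card (W.selmerGroup 2)
        ≤ 2 ^ (∑ v ∈ doorPlaces d, doorExp W v + 0) * Nat.card ((W.quadraticTwist (d : ℚ)).selmerGroup 2) := by
          simpa only [Nat.cast_ofNat, Finset.card_empty] using h2
      _ ≤ 2 ^ (transpCount W d + 2 * identCount W d + 0) * Nat.card ((W.quadraticTwist (d : ℚ)).selmerGroup 2) :=
          Nat.mul_le_mul_right _ (Nat.pow_le_pow_right Nat.two_pos (by omega))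

/-- **AN-33 Nalg `PureDoorSelmerCardEqAtNegDisc` PROVED** (REF1 §134 r134-2): for `W/ℚ` globally minimal elliptic with `Δ_W < 0` and a pure
door (`t = s = 0`), `#Sel₂(W^{(d)}) = #Sel₂(W)` — both inequalities of `GenusKolyTwistLocal.natCard_selmerGroup_twist_bounds_mixed` at `T = ∅`
(every prime of `d` is silent: `natCard_twoTorsion_eq_one_of_descMinimal`) and `R = ∅` (`twist_place_menu_infinite_rat`).
[cite: MazurRubin2010, Cor. 3.4 (ii)] [cite: Kramer1981, Prop. 3] -/
theorem pureDoorSelmerCardEqAtNegDisc_holds : PureDoorSelmerCardEqAtNegDisc := by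
  intro W _ _ hΔ d hadm ht hs
  have hdneg : d < 0 := hadm.1
  have hd0 : (d : ℚ) ≠ 0 := by exact_mod_cast hdneg.ne
  haveI := W.isElliptic_quadraticTwist hd0
  have hC : (1 : VariableChange ℚ) • W.quadraticTwist (d : ℚ) = W.quadraticTwist (d : ℚ) := one_smul _ _
  have hfin := fun v (_ : v ∉ (∅ : Finset (HeightOneSpectrum (𝓞 ℚ)))) => door_place_menu₅ W hadm hC v fun hdv =>
    natCard_twoTorsion_eq_one_of_descMinimal W hadm ht hs hdv
  have hinf := GenusKolyTwistLocal.twist_place_menu_infinite_rat W hΔ hd0 hC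
  obtain ⟨h1, h2, -⟩ := GenusKolyTwistLocal.natCard_selmerGroup_twist_bounds_mixed W (W.quadraticTwist (d : ℚ)) hd0 hC
    ∅ (fun _ => 0) ∅ (by simp) (by simp) (by simp) (by simp) (by simp) (by simp) hfin (fun w _ => hinf w)
  simp only [Nat.cast_ofNat, Finset.sum_empty, Finset.card_empty, add_zero, pow_zero, one_mul] at h1 h2
  unfold twistSelmerTwoCard
  exact le_antisymm h1 h2

end Summit.BirchSwinnertonDyer.Rank1Residual.F1Sign2.ANg16

end
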